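import Summits.AnomalousDissipation.AnomalousDissipation.Theorems.TaylorGreenLoudGalerkinStates.Negative.LoadBearing

/-!
# Sketch — crux-ideate stmt-AnomalousDissipation-2986 (MirrorVariety.GalerkinSteadyZerothLaw), round 1, ideator 3

First lemmas of the two idea cards of this seat, typed over existing declarations (no `sorry`):

* Card A `fatou-thick-designer-forces`:
  `FatouSelection` (pure measure theory, the first lemma), `ThickLoudForces` (the transfer target C⁺_A) and the
  kernel-checked composition `galerkinSteadyZerothLaw_of_thick : FatouSelection → ThickLoudForces → crux`.
* Card B `frozen-top-loud-completion`:
  `IsCompletion` (exact unforced high-band steady completion of a frozen low-band field), `ForceReadOff`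
  (the force is READ OFF the low-band budget — first lemma), `CompletionFlux` (loudness of a completion is the
  signed large-to-small flux), `BrouwerCovering` (finite-dimensional covering lemma), `OpenBallOfLoudForces`
  (transfer target C⁺_B, covering form) and `galerkinSteadyZerothLaw_of_openBall : OpenBallOfLoudForces → crux`.

The crux is used BY NAME (`Theses.MirrorVariety.GalerkinSteadyZerothLaw`); `crux_iff` records that the landed
vocabulary `IsSteadyState` (Theorems/TaylorGreenLoudGalerkinStates/Negative/LoadBearing.lean) restates it verbatim.
-/

noncomputable section

open scoped InnerProductSpace Topology ENNReal
open MeasureTheory Filter Set Metric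
open Literature.Analysis.FunctionSpaces Literature.Analysis.FunctionSpaces.Torus
open Summit.AnomalousDissipation.AnomalousDissipation.Theorems.TaylorGreenLoudGalerkinStates.Negative

namespace Summit.AnomalousDissipation.AnomalousDissipation.Cruxes.GalerkinSteadyZerothLaw.Ideator3

/-- The physical flat unit torus (local notation). -/
local notation "𝕋³" => UnitAddTorus (Fin 3)
/-- Velocity values (local notation). -/
local notation "E³" => EuclideanSpace ℝ (Fin 3)

/-! ## §0 Vocabulary shared by both cards -/

/-- Admissible steady force: smooth, divergence free, mean zero (the crux's three clauses on `f`). -/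
def IsAdmissibleForce (f : 𝕋³ → E³) : Prop :=
  IsSmooth f ∧ IsDivFree f ∧ HasZeroMean f

/-- Loud bounded admissible Galerkin steady state at `(ν, N)` for the force `f` with budgets `(E, ε)`:
the crux's bracket (`IsSteadyState`, landed vocabulary) `∧ ∫|U|² ≤ E ∧ ε ≤ ν‖∇U‖²`. -/
def IsLoudBounded (ν : ℝ) (N : ℕ) (f : 𝕋³ → E³) (E ε : ℝ) (U : 𝕋³ → E³) : Prop :=
  IsSteadyState ν N f U ∧ ∫ x, ‖U x‖ ^ 2 ≤ E ∧ ε ≤ ν * gradNormSq U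

/-- The crux, verbatim, in this vocabulary (definitional). -/
theorem crux_iff :
    Theses.MirrorVariety.GalerkinSteadyZerothLaw ↔
      ∃ f : 𝕋³ → E³, IsSmooth f ∧ IsDivFree f ∧ HasZeroMean f ∧ ∃ (ν : ℕ → ℝ) (E ε : ℝ),
        (∀ j, 0 < ν j) ∧ Tendsto ν atTop (𝓝 0) ∧ 0 < ε ∧
        ∀ j, ∃ᶠ N in atTop, ∃ U : 𝕋³ → E³, IsLoudBounded (ν j) N f E ε U :=
  Iff.rfl

/-! ## Card A — `fatou-thick-designer-forces`

### First lemma: Fatou selection (reverse Fatou for sets, twice) -/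

/-- **Fatou selection** (first lemma of card A; pure measure theory, provable now).
If measurable sets `A j N` inside one fixed ball of `ℝᵐ` have Lebesgue measure `≥ p > 0` for infinitely many `N`
at every level `j`, then ONE point lies in `A j N` for infinitely many `N` at infinitely many levels `j`:
`vol(limsup_N A j N) ≥ p` for every `j` (continuity from above inside a set of finite measure), hence
`vol(limsup_j limsup_N A j N) ≥ p > 0`, hence that set is non-empty. -/
def FatouSelection : Prop :=
  ∀ (m : ℕ) (A : ℕ → ℕ → Set (EuclideanSpace ℝ (Fin m))) (R : ℝ) (p : ℝ≥0∞),
    0 < p → (∀ j N, MeasurableSet (A j N)) → (∀ j N, A j N ⊆ closedBall 0 R) →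
    (∀ j, ∃ᶠ N in atTop, p ≤ volume (A j N)) →
    ∃ a, ∃ᶠ j in atTop, ∃ᶠ N in atTop, a ∈ A j N

/-- Reverse Fatou along `ℕ` inside a set of finite measure: if `p ≤ μ (A N)` for infinitely many `N`, then
`p ≤ μ (limsup A)` (written as `⋂ n, ⋃ N ≥ n, A N`). [folklore] -/
theorem reverse_fatou_nat {α : Type*} [MeasurableSpace α] {μ : Measure α} {A : ℕ → Set α} {S : Set α}
    (hS : μ S ≠ ∞) (hA : ∀ N, MeasurableSet (A N)) (hAS : ∀ N, A N ⊆ S) {p : ℝ≥0∞}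
    (hp : ∃ᶠ N in atTop, p ≤ μ (A N)) :
    p ≤ μ (⋂ n, ⋃ N, ⋃ (_ : n ≤ N), A N) := by
  have hDmeas : ∀ n, MeasurableSet (⋃ N, ⋃ (_ : n ≤ N), A N) := fun n =>
    MeasurableSet.iUnion fun N => MeasurableSet.iUnion fun _ => hA N
  have hDS : ∀ n, (⋃ N, ⋃ (_ : n ≤ N), A N) ⊆ S := fun n =>
    Set.iUnion_subset fun N => Set.iUnion_subset fun _ => hAS N
  have hanti : ∀ n n', n ≤ n' → (⋃ N, ⋃ (_ : n' ≤ N), A N) ⊆ ⋃ N, ⋃ (_ : n ≤ N), A N := by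
    intro n n' hnn' a ha
    simp only [Set.mem_iUnion] at ha ⊢
    obtain ⟨N, hN, haN⟩ := ha
    exact ⟨N, hnn'.trans hN, haN⟩
  have hanti' : Antitone fun n => ⋃ N, ⋃ (_ : n ≤ N), A N := fun n n' hnn' => hanti n n' hnn'
  have hfin : ∃ n, μ (⋃ N, ⋃ (_ : n ≤ N), A N) ≠ ∞ :=
    ⟨0, ((measure_mono (hDS 0)).trans_lt hS.lt_top).ne⟩
  have key : μ (⋂ n, ⋃ N, ⋃ (_ : n ≤ N), A N) = ⨅ n, μ (⋃ N, ⋃ (_ : n ≤ N), A N) :=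
    hanti'.measure_iInter (fun n => (hDmeas n).nullMeasurableSet) hfin
  rw [key]
  refine le_iInf fun n => ?_
  obtain ⟨N, hN, hpN⟩ := Filter.frequently_atTop.mp hp n
  exact hpN.trans (measure_mono fun a ha => Set.mem_iUnion.mpr ⟨N, Set.mem_iUnion.mpr ⟨hN, ha⟩⟩)

/-- **`FatouSelection` holds** (proved: the first lemma of card A is a theorem of Mathlib-level measure
theory). [folklore] -/
theorem fatouSelection_holds : FatouSelection := by
  intro m A R p hp hmeas hball hthick
  have hvolS : volume (closedBall (0 : EuclideanSpace ℝ (Fin m)) R) ≠ ∞ :=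
    (isCompact_closedBall _ _).measure_lt_top.ne
  -- limsup in N at each level j
  have hBmeas : ∀ j, MeasurableSet (⋂ n, ⋃ N, ⋃ (_ : n ≤ N), A j N) := fun j =>
    MeasurableSet.iInter fun n => MeasurableSet.iUnion fun N => MeasurableSet.iUnion fun _ => hmeas j N
  have hBball : ∀ j, (⋂ n, ⋃ N, ⋃ (_ : n ≤ N), A j N) ⊆ closedBall 0 R := by
    intro j a ha
    have ha0 := Set.mem_iInter.mp ha 0
    simp only [Set.mem_iUnion] at ha0
    obtain ⟨N, -, haN⟩ := ha0
    exact hball j N haN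
  have hBvol : ∀ j, p ≤ volume (⋂ n, ⋃ N, ⋃ (_ : n ≤ N), A j N) := fun j =>
    reverse_fatou_nat hvolS (hmeas j) (hball j) (hthick j)
  -- limsup in j
  have hC : p ≤ volume (⋂ n, ⋃ j, ⋃ (_ : n ≤ j), ⋂ n', ⋃ N, ⋃ (_ : n' ≤ N), A j N) :=
    reverse_fatou_nat hvolS hBmeas hBball (Filter.Frequently.of_forall hBvol)
  obtain ⟨a, ha⟩ := nonempty_of_measure_ne_zero (hp.trans_le hC).ne'
  refine ⟨a, Filter.frequently_atTop.mpr fun n => ?_⟩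
  have han := Set.mem_iInter.mp ha n
  simp only [Set.mem_iUnion] at han
  obtain ⟨j, hj, haj⟩ := han
  refine ⟨j, hj, Filter.frequently_atTop.mpr fun n' => ?_⟩
  have han' := Set.mem_iInter.mp haj n'
  simp only [Set.mem_iUnion] at han'
  obtain ⟨N, hN, haN⟩ := han'
  exact ⟨N, hN, haN⟩

/-! ### Transfer target C⁺_A: per-level THICKNESS of loud designer forces -/

/-- **C⁺_A — thick loud designer forces.** A finite-dimensional LINEAR INJECTIVE family `Φ : ℝᵐ →ₗ forces` of
admissible steady forces (intended instance: real coordinates of `c ↦ realTrigPoly S (lerayCoeff ∘ coeffExt S c)`,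
the force space `P_S` of route BaireTransfer; linearity + injectivity exclude the constant families `Φ ≡ f*` that
would make C⁺_A a rewording of the crux), budgets `E, ε`, a radius `R`, a thickness floor `p > 0` and viscosities
`ν_j → 0⁺` such that AT EVERY LEVEL `j`, FOR INFINITELY MANY RESOLUTIONS `N`, the parameters `a ∈ B̄_R` whose force
`Φ a` admits a loud bounded Galerkin steady state at `(ν_j, N)` contain a measurable set of volume `≥ p`.
The designer forces may depend on `(j, N)`; only the thickness floor is uniform. -/
def ThickLoudForces : Prop :=
  ∃ (m : ℕ) (Φ : EuclideanSpace ℝ (Fin m) →ₗ[ℝ] (𝕋³ → E³)),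
    Function.Injective Φ ∧ (∀ a, IsAdmissibleForce (Φ a)) ∧
    ∃ (ν : ℕ → ℝ) (E ε R : ℝ) (p : ℝ≥0∞), (∀ j, 0 < ν j) ∧ Tendsto ν atTop (𝓝 0) ∧ 0 < ε ∧ 0 < p ∧
      ∀ j, ∃ᶠ N in atTop, ∃ A : Set (EuclideanSpace ℝ (Fin m)),
        MeasurableSet A ∧ A ⊆ closedBall 0 R ∧ p ≤ volume A ∧
          ∀ a ∈ A, ∃ U : 𝕋³ → E³, IsLoudBounded (ν j) N (Φ a) E ε U

/-- **The transfer of card A, kernel-checked:** Fatou selection + per-level thickness ⇒ the crux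
(one fixed force, along the extracted subsequence of viscosities; the crux's `∃ᶠ N` is matched exactly). -/
theorem galerkinSteadyZerothLaw_of_thick (hF : FatouSelection) (h : ThickLoudForces) :
    Theses.MirrorVariety.GalerkinSteadyZerothLaw := by
  classical
  obtain ⟨m, Φ, -, hΦ, ν, E, ε, R, p, hν, hν0, hε, hp, hthick⟩ := h
  -- the sets of good parameters, and a measurable thick inner approximation chosen at each (j, N)
  let good : ℕ → ℕ → Set (EuclideanSpace ℝ (Fin m)) := fun j N =>
    {a | ∃ U : 𝕋³ → E³, IsLoudBounded (ν j) N (Φ a) E ε U}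
  have key : ∀ j N, ∃ A : Set (EuclideanSpace ℝ (Fin m)), MeasurableSet A ∧ A ⊆ closedBall 0 R ∧
      A ⊆ good j N ∧ ((∃ A' : Set (EuclideanSpace ℝ (Fin m)), MeasurableSet A' ∧ A' ⊆ closedBall 0 R ∧
        p ≤ volume A' ∧ ∀ a ∈ A', ∃ U : 𝕋³ → E³, IsLoudBounded (ν j) N (Φ a) E ε U) → p ≤ volume A) := by
    intro j N
    by_cases hex : ∃ A' : Set (EuclideanSpace ℝ (Fin m)), MeasurableSet A' ∧ A' ⊆ closedBall 0 R ∧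
        p ≤ volume A' ∧ ∀ a ∈ A', ∃ U : 𝕋³ → E³, IsLoudBounded (ν j) N (Φ a) E ε U
    · obtain ⟨A', hm, hb, hpA, hg⟩ := hex
      exact ⟨A', hm, hb, fun a ha => hg a ha, fun _ => hpA⟩
    · exact ⟨∅, MeasurableSet.empty, empty_subset _, empty_subset _, fun h' => absurd h' hex⟩
  choose A hAmeas hAball hAgood hAthick using key
  have hfreq : ∀ j, ∃ᶠ N in atTop, p ≤ volume (A j N) := fun j =>
    (hthick j).mono fun N hN => hAthick j N hN
  obtain ⟨a, ha⟩ := hF m A R p hp hAmeas hAball hfreq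
  obtain ⟨φ, hφ, hφa⟩ := Filter.extraction_of_frequently_atTop ha
  refine ⟨Φ a, (hΦ a).1, (hΦ a).2.1, (hΦ a).2.2, ν ∘ φ, E, ε, fun k => hν (φ k),
    hν0.comp hφ.tendsto_atTop, hε, fun k => ?_⟩
  exact (hφa k).mono fun N hN => hAgood _ _ hN

/-- **Card A's transfer, unconditional:** per-level thickness alone implies the crux. -/
theorem galerkinSteadyZerothLaw_of_thick' (h : ThickLoudForces) :
    Theses.MirrorVariety.GalerkinSteadyZerothLaw :=
  galerkinSteadyZerothLaw_of_thick fatouSelection_holds h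

/-! ## Card B — `frozen-top-loud-completion`

### Vocabulary: frozen low band, exact unforced high-band completion -/

/-- Band-limitation to the annulus `L² < |k|² ≤ N²` (all modes of the closed ball `freqBall L` vanish too). -/
def IsAnnulusLimited (L N : ℕ) (W : 𝕋³ → E³) : Prop :=
  IsBandLimited N W ∧ ∀ k ∈ freqBall L, UnitAddTorus.mFourierCoeff (EuclideanSpace.complexify ∘ W) k = 0

/-- **Exact unforced high-band steady completion** of the frozen low-band field `φ` at `(ν, N)`: an admissible
field `W` living in the annulus `(L, N]` that solves the tested Galerkin equations against every admissible
ANNULUS test — no force appears (the force lives in the low band). This is the steady small-eddy equation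
`νA z + Q_m B(y + z, y + z) = Q_m f` of the approximate-inertial-manifold literature with `Q_m f = 0`
(Titi 1990; Foias–Manley–Temam 1988; FMRT 2001 Ch. III §4 (4.7), (4.16)), taken OUTSIDE its slaved regime. -/
def IsCompletion (ν : ℝ) (L N : ℕ) (φ W : 𝕋³ → E³) : Prop :=
  IsSmooth W ∧ IsDivFree W ∧ HasZeroMean W ∧ IsAnnulusLimited L N W ∧
    ∀ a : 𝕋³ → E³, IsSmooth a → IsDivFree a → IsAnnulusLimited L N a →
      ∫ x, (⟪(φ + W) x, convect (φ + W) a x⟫_ℝ + ν * ⟪W x, laplacian a x⟫_ℝ) = 0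

/-! ### First lemma (B1): the force is read off the low-band budget -/

/-- **B1 — force read-off (first lemma of card B; provable now, size M).** If `φ` is an admissible low-band
field and `W` an exact unforced high-band completion of it at `(ν, N)`, then `U := φ + W` IS an admissible
Galerkin steady state at `(ν, N)` for SOME admissible force `f` band-limited to the low ball — namely the Riesz
representative, in the finite-dimensional space of low-band solenoidal real trigonometric polynomials, of the
functional `a ↦ -∫⟪U, (U·∇)a⟫ - ν∫⟪φ, Δa⟫` (i.e. `f = P_L^σ B(U,U) + νAφ`); the full tested equation follows by
splitting a band-limited test into its low-band and annulus parts (both again smooth and div-free). -/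
def ForceReadOff : Prop :=
  ∀ (ν : ℝ) (L N : ℕ) (φ W : 𝕋³ → E³), L ≤ N → IsAdmissibleForce φ → IsBandLimited L φ →
    IsCompletion ν L N φ W →
    ∃ f : 𝕋³ → E³, IsAdmissibleForce f ∧ IsBandLimited L f ∧ IsSteadyState ν N f (φ + W)

/-! ### B2: loudness of a completion is the signed large-to-small flux -/

/-- **B2 — completion flux identity (provable now, size S–M).** Testing the completion equation with `a := W`:
`ν‖∇W‖² = ∫⟪U, (U·∇)W⟫ = -∫⟪(U·∇)φ, W⟫`, `U = φ + W` — the completion is exactly as loud as the power it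
extracts from the frozen field (Reynolds stress against the frozen strain plus the Leonard term). -/
def CompletionFlux : Prop :=
  ∀ (ν : ℝ) (L N : ℕ) (φ W : 𝕋³ → E³), IsAdmissibleForce φ → IsBandLimited L φ →
    IsCompletion ν L N φ W →
    ν * gradNormSq W = -∫ x, ⟪convect (φ + W) φ x, W x⟫_ℝ

/-! ### B3: the finite-dimensional covering lemma -/

/-- **B3 — Brouwer covering (provable now from the tree's Brouwer fixed point theorem + Mathlib's inverse
function theorem, size M).** A `C¹` map of `ℝᵐ` with invertible derivative at `b₀` covers, together with EVERY
continuous perturbation of sup-size `≤ r`, the whole ball of radius `r` about `Q b₀` — images of small balls are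
stably thick. Applied to the ν-free quadratic low-band map `Q_L(φ) = P_L^σ B(φ,φ)` perturbed by `νAφ` and by the
(continuous, small) feedback of a family of loud completions, it yields a FIXED open ball of loud forces. -/
def BrouwerCovering : Prop :=
  ∀ (m : ℕ) (Q : EuclideanSpace ℝ (Fin m) → EuclideanSpace ℝ (Fin m))
    (Q' : EuclideanSpace ℝ (Fin m) ≃L[ℝ] EuclideanSpace ℝ (Fin m)) (b₀ : EuclideanSpace ℝ (Fin m)),
    HasStrictFDerivAt Q (Q' : EuclideanSpace ℝ (Fin m) →L[ℝ] EuclideanSpace ℝ (Fin m)) b₀ →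
    ∃ r > 0, ∃ s > 0, ∀ ρ : EuclideanSpace ℝ (Fin m) → EuclideanSpace ℝ (Fin m),
      ContinuousOn ρ (closedBall b₀ s) → (∀ b ∈ closedBall b₀ s, ‖ρ b‖ ≤ r) →
      closedBall (Q b₀) r ⊆ (fun b => Q b + ρ b) '' closedBall b₀ s

/-! ### Transfer target C⁺_B (covering form): a fixed open ball of loud low-band forces -/

/-- **C⁺_B — an L²-ball of low-band forces, every member of which is loud at every level.** This is what the
frozen-top construction delivers through `BrouwerCovering`; it implies the crux for an OPEN SET of forces. -/
def OpenBallOfLoudForces : Prop :=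
  ∃ (L : ℕ) (g₀ : 𝕋³ → E³) (r : ℝ), IsAdmissibleForce g₀ ∧ IsBandLimited L g₀ ∧ 0 < r ∧
    ∃ (ν : ℕ → ℝ) (E ε : ℝ), (∀ j, 0 < ν j) ∧ Tendsto ν atTop (𝓝 0) ∧ 0 < ε ∧
      ∀ g : 𝕋³ → E³, IsAdmissibleForce g → IsBandLimited L g → ∫ x, ‖g x - g₀ x‖ ^ 2 ≤ r ^ 2 →
        ∀ j, ∃ᶠ N in atTop, ∃ U : 𝕋³ → E³, IsLoudBounded (ν j) N g E ε U

/-- **The transfer of card B, kernel-checked** (take `g := g₀`). -/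
theorem galerkinSteadyZerothLaw_of_openBall (h : OpenBallOfLoudForces) :
    Theses.MirrorVariety.GalerkinSteadyZerothLaw := by
  obtain ⟨L, g₀, r, hg₀, hband, hr, ν, E, ε, hν, hν0, hε, hall⟩ := h
  have hself : ∫ x, ‖g₀ x - g₀ x‖ ^ 2 ≤ r ^ 2 := by
    simp only [sub_self, norm_zero, ne_eq, OfNat.ofNat_ne_zero, not_false_eq_true, zero_pow,
      integral_zero]
    positivity
  exact ⟨g₀, hg₀.1, hg₀.2.1, hg₀.2.2, ν, E, ε, hν, hν0, hε, hall g₀ hg₀ hband hself⟩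

/-- Card B's covering target is a (much) stronger instance of card A's thickness target: a fixed ball is thick.
Recorded as the implication the crux-plan stage may use to share one transfer (statement only). -/
def OpenBallGivesThick : Prop :=
  OpenBallOfLoudForces → ThickLoudForces

end Summit.AnomalousDissipation.AnomalousDissipation.Cruxes.GalerkinSteadyZerothLaw.Ideator3

end
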